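import Mathlib
import Summits.Ventures.PercRepro2.Defs
import Summits.Ventures.PercRepro2.Independence
import Summits.Ventures.PercRepro2.Harris
import Summits.Ventures.PercRepro2.Graph
import Summits.Ventures.PercRepro2.Exploration
import Summits.Ventures.PercRepro2.Events
import Summits.Ventures.PercRepro2.FourFunctions
import Summits.Ventures.PercRepro2.Induced
import Summits.Ventures.PercRepro2.Frontier
import Summits.Ventures.PercRepro2.ObsIndependence
import Summits.Ventures.PercRepro2.BHK
import Summits.Ventures.PercRepro2.BHKEvents
import Summits.Ventures.PercRepro2.VdBKahn
import Summits.Ventures.PercRepro2.BHKAvoid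

/-!
# Harris for the cluster of `s` under avoidance by the cluster of `o` (PercRepro2, p2)

The positive-association companion of `bhk_cross_cluster_avoid`: for up-sets `𝓤, 𝓥` of vertex sets
(events of the cluster of `s`) and an avoid set `X ∋ s` for the cluster of `o`,

  `P(C_s ∈ 𝓤, o ↮ X) · P(C_s ∈ 𝓥, o ↮ X) ≤ P(C_s ∈ 𝓤 ∩ 𝓥, o ↮ X) · P(o ↮ X)`.

Proof: explore the cluster `W` of `o` first (`prob_clusterIn_inter_avoid_eq_expect`); the three masses
are `E[g_𝓤(C_o) 1_Q]`, `E[g_𝓥(C_o) 1_Q]`, `E[g_{𝓤∩𝓥}(C_o) 1_Q]` with `g_𝓥 = delClusterProb s 𝓥` the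
probability of the event in `G ∖ W` (antitone in `W`); Harris in `G ∖ W` gives `g_𝓤 g_𝓥 ≤ g_{𝓤∩𝓥}`
pointwise, and BHK06 Theorem 1.3 (`bhk_induced`, applied to the monotone functionals `1 − g_𝓤`,
`1 − g_𝓥`) gives `E[g_𝓤 1_Q] E[g_𝓥 1_Q] ≤ E[g_𝓤 g_𝓥 1_Q] P(Q)`.

This is the inequality (c1) of P2-G19-YCLUSTER.md §3h, `Cov(u ∈ C_s, y ∈ C_s | C_o avoids {s, y}) ≥ 0`,
needed for the `s`-edge case of (UNI-R⁺_o).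
-/

namespace Summit.Ventures.PercRepro2

section CondHarris

variable {V : Type*} {E : Type*} [Fintype V] [DecidableEq V] [Fintype E] [DecidableEq E]
  {R : Type*} [CommRing R] [LinearOrder R] [IsStrictOrderedRing R]

omit [Fintype V] [DecidableEq V] [Fintype E] [DecidableEq E] [LinearOrder R] [IsStrictOrderedRing R] in
/-- Closing the edges at `W` is monotone in the configuration. -/
lemma delConfig_mono_cfg_ycl (ends : E → Sym2 V) (W : Set V) {ω ω' : Config E} (h : ω ≤ ω') :
    delConfig ends W ω ≤ delConfig ends W ω' := by
  intro e
  by_cases he : e ∈ touches ends W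
  · rw [delConfig_apply_of_mem he, delConfig_apply_of_mem he]
  · rw [delConfig_apply_of_notMem he, delConfig_apply_of_notMem he]
    exact h e

omit [Fintype V] [DecidableEq V] [Fintype E] [DecidableEq E] [LinearOrder R] [IsStrictOrderedRing R] in
/-- The event `{C_s ∈ 𝓤 in G ∖ W}` is increasing when `𝓤` is an up-set. -/
lemma isUpperSet_delCluster_avoid_ycl (ends : E → Sym2 V) (s : V) (W : Set V) {𝓤 : Set (Set V)}
    (h𝓤 : IsUpperSet 𝓤) :
    IsUpperSet {ω : Config E | cluster ends (delConfig ends W ω) s ∈ 𝓤} := by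
  intro ω ω' hle hω
  exact h𝓤 (cluster_mono (delConfig_mono_cfg_ycl ends W hle) s) hω

omit [Fintype V] [DecidableEq V] in
/-- **Harris in `G ∖ W`**: `g_𝓤(W) · g_𝓥(W) ≤ g_{𝓤∩𝓥}(W)`. -/
lemma delClusterProb_mul_le_ycl (p : E → R) (hp : IsProbVec p) (ends : E → Sym2 V) (s : V)
    {𝓤 𝓥 : Set (Set V)} (h𝓤 : IsUpperSet 𝓤) (h𝓥 : IsUpperSet 𝓥) (W : Set V) :
    delClusterProb p ends s 𝓤 W * delClusterProb p ends s 𝓥 W ≤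
      delClusterProb p ends s (𝓤 ∩ 𝓥) W := by
  unfold delClusterProb
  have h := prob_mul_prob_le_prob_inter hp (isUpperSet_delCluster_avoid_ycl ends s W h𝓤)
    (isUpperSet_delCluster_avoid_ycl ends s W h𝓥)
  refine h.trans (le_of_eq ?_)
  congr 1

/-- **Harris for the cluster of `s` under avoidance by the cluster of `o`**: for up-sets `𝓤, 𝓥` and
`s ∈ X`, `P(C_s ∈ 𝓤, o ↮ X) · P(C_s ∈ 𝓥, o ↮ X) ≤ P(C_s ∈ 𝓤 ∩ 𝓥, o ↮ X) · P(o ↮ X)`. -/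
theorem harris_same_cluster_avoid (p : E → R) (hp : IsProbVec p) (ends : E → Sym2 V) (o s : V)
    {X : Finset V} (hs : s ∈ X) {𝓤 𝓥 : Set (Set V)} (h𝓤 : IsUpperSet 𝓤) (h𝓥 : IsUpperSet 𝓥) :
    prob p (clusterInEvent ends s 𝓤 ∩ avoidAll ends o X) *
        prob p (clusterInEvent ends s 𝓥 ∩ avoidAll ends o X) ≤
      prob p (clusterInEvent ends s (𝓤 ∩ 𝓥) ∩ avoidAll ends o X) * prob p (avoidAll ends o X) := by
  classical
  set gU := delClusterProb p ends s 𝓤 with hgU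
  set gV := delClusterProb p ends s 𝓥 with hgV
  set gUV := delClusterProb p ends s (𝓤 ∩ 𝓥) with hgUV
  have hU_anti : Antitone gU := delClusterProb_anti p hp ends s h𝓤
  have hV_anti : Antitone gV := delClusterProb_anti p hp ends s h𝓥
  have hU1 : ∀ W, gU W ≤ 1 := delClusterProb_le_one p hp ends s 𝓤
  have hV1 : ∀ W, gV W ≤ 1 := delClusterProb_le_one p hp ends s 𝓥
  have hU0 : ∀ W, 0 ≤ gU W := delClusterProb_nonneg p hp ends s 𝓤
  have hV0 : ∀ W, 0 ≤ gV W := delClusterProb_nonneg p hp ends s 𝓥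
  -- the three masses as expectations over the cluster of `o`
  have tower : ∀ 𝓦 : Set (Set V), prob p (clusterInEvent ends s 𝓦 ∩ avoidAll ends o X) =
      expect p (fun ω => delClusterProb p ends s 𝓦 (cluster ends ω o) *
        (avoidAll ends o X).indicator 1 ω) := by
    intro 𝓦
    have e := prob_clusterIn_inter_avoid_eq_expect p ends o s hs Set.univ 𝓦
    simp only [Set.indicator_univ, Pi.one_apply, one_mul] at e
    have e' : clusterInEvent ends o Set.univ ∩ clusterInEvent ends s 𝓦 ∩ avoidAll ends o X =
        clusterInEvent ends s 𝓦 ∩ avoidAll ends o X := by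
      ext ω; simp [clusterInEvent]
    rw [e'] at e
    exact e
  have eU := tower 𝓤
  have eV := tower 𝓥
  have eUV := tower (𝓤 ∩ 𝓥)
  rw [← hgU] at eU
  rw [← hgV] at eV
  rw [← hgUV] at eUV
  -- BHK06 Theorem 1.3 for the monotone functionals `1 − gU`, `1 − gV` of the cluster of `o`
  have hF₁ : Monotone (fun W => 1 - gU W) := fun W W' h => by
    simp only
    linarith [hU_anti h]
  have hF₂ : Monotone (fun W => 1 - gV W) := fun W W' h => by
    simp only
    linarith [hV_anti h]
  have hF₁0 : ∀ W, 0 ≤ 1 - gU W := fun W => by linarith [hU1 W]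
  have hF₂0 : ∀ W, 0 ≤ 1 - gV W := fun W => by linarith [hV1 W]
  have key := bhk_induced p hp ends o hF₁ hF₂ hF₁0 hF₂0 Finset.univ X X (Finset.subset_univ _)
    (Finset.subset_univ _)
  simp only [Finset.inter_self, Finset.union_self, REvent_univ] at key
  have e : ∀ F : Set V → R, clusterObs ends Finset.univ o F * (avoidAll ends o X).indicator 1 =
      fun ω => F (cluster ends ω o) * (avoidAll ends o X).indicator 1 ω := by
    intro F
    funext ω
    simp only [Pi.mul_apply, clusterObs_apply, clusterIn_univ]
  rw [e, e, e] at key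
  simp only [Pi.mul_apply] at key
  have eR : prob p (avoidAll ends o X) =
      expect p fun ω => (avoidAll ends o X).indicator 1 ω := prob_eq_expect_indicator p _
  have e1 : expect p (fun ω => (1 - gU (cluster ends ω o)) * (avoidAll ends o X).indicator 1 ω) =
      prob p (avoidAll ends o X) - prob p (clusterInEvent ends s 𝓤 ∩ avoidAll ends o X) := by
    rw [eU, eR, ← expect_sub]
    congr 1
    funext ω
    simp only [Pi.sub_apply]
    ring
  have e2 : expect p (fun ω => (1 - gV (cluster ends ω o)) * (avoidAll ends o X).indicator 1 ω) =
      prob p (avoidAll ends o X) - prob p (clusterInEvent ends s 𝓥 ∩ avoidAll ends o X) := by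
    rw [eV, eR, ← expect_sub]
    congr 1
    funext ω
    simp only [Pi.sub_apply]
    ring
  have e3 : expect p (fun ω => (1 - gU (cluster ends ω o)) * (1 - gV (cluster ends ω o)) *
      (avoidAll ends o X).indicator 1 ω) =
      prob p (avoidAll ends o X) - prob p (clusterInEvent ends s 𝓤 ∩ avoidAll ends o X) -
        prob p (clusterInEvent ends s 𝓥 ∩ avoidAll ends o X) +
        expect p (fun ω => gU (cluster ends ω o) * gV (cluster ends ω o) *
          (avoidAll ends o X).indicator 1 ω) := by
    rw [eU, eV, eR, ← expect_sub, ← expect_sub, ← expect_add]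
    congr 1
    funext ω
    simp only [Pi.sub_apply, Pi.add_apply]
    ring
  rw [e1, e2, e3] at key
  -- Harris in `G ∖ W`, integrated
  have hpt : expect p (fun ω => gU (cluster ends ω o) * gV (cluster ends ω o) *
      (avoidAll ends o X).indicator 1 ω) ≤
      expect p (fun ω => gUV (cluster ends ω o) * (avoidAll ends o X).indicator 1 ω) := by
    refine expect_mono hp fun ω => ?_
    exact mul_le_mul_of_nonneg_right (delClusterProb_mul_le_ycl p hp ends s h𝓤 h𝓥 _)
      (Set.indicator_apply_nonneg fun _ => zero_le_one)
  rw [← eUV] at hpt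
  have hQ := prob_nonneg hp (avoidAll ends o X)
  nlinarith [key, hpt, hQ, mul_le_mul_of_nonneg_right hpt hQ]

end CondHarris

end Summit.Ventures.PercRepro2
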